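import Summits.BirchSwinnertonDyer.Rank1Residual.Additive.QuadraticTwistCoefficients
import Literature.NumberTheory.EllipticCurves.Pal2012.QuadraticTwistPeriodProofs
import Literature.NumberTheory.EllipticCurves.CuspFormTwistRatPlusSymbol
import Literature.NumberTheory.EllipticCurves.CuspFormTwistRatPlusSymbolOdd
import Literature.NumberTheory.EllipticCurves.PAdicLFunctionProofs
import Literature.NumberTheory.QuadraticFields.JacobiCharacterPrimitiveProofs
import Literature.NumberTheory.Sieve.LargeSieveCharacters
import HarnessLib

/-!
# The newform, the plus modular symbol and the period of a curve READ ON ITS QUADRATIC TWIST by an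
# ARBITRARY odd fundamental discriminant `D`: `f_W = f_{W₀} ⊗ χ_D`, `[r]⁺_{f_W} = c₀ · ∑_{u mod |D|} (D/u) [r + u/|D|]^{sgn D}_{f_{W₀}}`
# with ONE constant `c₀ ∈ ℚ`, `|c₀|_p = 1` (cell `b2b-bsdres`, seat additive-p4 GEN 22, line V41 "minimal-twist reach")

HONEST FRAMING (cell `b2b-bsdres`, run/shared/lean/b2b/bsd-rank1-residual/, verbatim in every
file): the goal of the cell is to DELETE the COMBINATION-SHAPED residual classes of the
Birch–Swinnerton-Dyer formula for ALL analytic-rank `≤ 1` elliptic curves over `ℚ` — "full BSD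
formula for every rank `≤ 1` curve in class `C`" assembled STRICTLY from published theorems — so
that the rank-`≤ 1` remainder becomes exactly the CONSTRUCTION-SHAPED classes, which are TYPED
(missing-input `Prop`s), NOT attempted. This is not "finishing BSD". Seat additive-p4 (X3♯/X4♯
direct): research route on the CONSTRUCTION-SHAPED class X4; no claim beyond the stated classes;
labels / marks UNCHANGED; NOTHING here is booked. THEOREMS ONLY (no definition, no Literature fact).

## Why (the line)

GEN 21 (`Additive/X4TwistLevelLoweringCertificate*.lean`, `X4/KuriharaLevelLoweringTwist*.lean`)
read the plus modular symbol — hence every Kurihara number and the level-lowering certificate — of a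
curve `W` ADDITIVE at `p` on its twist `V = W ⊗ χ_{p*}` when `V` is SEMISTABLE at `p` (cells
(G, e = 2) and (M)), at level `N/p²` resp. `N/p`. The mechanism is not tied to `p*`: for ANY odd
fundamental discriminant `D` with `W ≅ W₀ ⊗ χ_D` the same identities hold with `W₀` of level
`N₀ ∣ N_W`, and `W₀ :=` the CONDUCTOR-MINIMAL twist of `W` (PARI `ellminimaltwist`) is the best
choice for the instruments (`msfromell` is feasible up to `N₀ ≈ 3·10⁴`). Census of this seat
(kit j135748, the 2 489 open X4 cells at `p ≥ 5` of cc-eng-1's R203 companions): `N₀ ≤ 3·10⁴` on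
554 / 1 157 LOWER rows, 54 / 176 TAM rows, 105 / 276 rank-one unit rows, 150 / 470 rank-one Tamagawa
rows — against 21 / 5 / 1 / 12 for `N` itself. Everything below is general in `D`; the `D = p*`
files are the special case.

## What (all PROVED; inputs = tree theorems only)

* (§1 = file `Additive/QuadraticTwistCoefficients.lean`: `aₙ(W₀^{(D)}) = (n/|D|)·aₙ(W₀)` for ALL `n`
  when the twist is ADDITIVE at the primes dividing `D`, e.g. `W₀` good or multiplicative there.)
* §2 `charTwist_eq_of_isNewformOf_quadraticTwist`: `f_W = (f_{W₀})_{χ_D}` as cusp forms of level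
  `N_W` (`χ_D = jacobiChar |D|`, the Kronecker symbol; `q`-expansion principle
  `eq_of_forall_cuspCoeff_eq_gamma0` + `cuspCoeff_charTwist`).
* §3 `exists_rat_ratPlusSymbol_eq_twistSum_of_pos / _of_neg`: the ℚ-identity with ONE constant and
  its period relation (tree `exists_rat_forall_ratPlusSymbol_charTwist_eq[_of_odd]`, Shimura 3.64 at
  the symbol level): `D > 0` plus ↔ plus, `D < 0` plus ↔ MINUS.
* §4 `norm_ratCast_eq_one_of_twist_of_pos / _of_neg`: `|c₀|_p = 1` at every odd `p` for the
  globally minimal `W`, from Pal 2012 Thm. 3.2 with `ũ = 1` — PROVED in the tree for every such `D`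
  (`sqrt_mul_realPeriodRat_eq_of_twist_of_pos_of_squarefree`,
  `realPeriodRat_mul_sqrt_eq_of_twist_of_neg_of_squarefree`) —, `τ(χ_D)² = D`
  (`gaussSum_mul_gaussSum_inv`) and the period transfers `Ω(W) = u_W Ω⁺_{f_W}`,
  `Ω(W₀) = u₀ Ω⁺_{f_{W₀}}` resp. `|Ω⁻(W₀)| = u₀ Ω⁻_{f_{W₀}}` (`p`-adic units; the cell's Manin-type
  binders): `c₀² = (u_W/u₀)²` resp. `(u_W/(c_∞ u₀))²`. NO case analysis on the sign of `τ`.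

References: Shimura 1971 Prop. 3.64; Mazur–Tate–Teitelbaum 1986 §I.8 [MazurTateTeitelbaum1986Invent];
Pal 2012 Thm. 3.2 / Prop. 2.5 [Pal2012]; Silverman AEC X.2 [SilvermanAEC2009]; cell files
HOME/b2b-bsdres-additive-p4/README §24–§25.
-/


noncomputable section

open scoped Classical MatrixGroups ModularForm NumberTheorySymbols
open CongruenceSubgroup WeierstrassCurve Literature.NumberTheory.EllipticCurves
  Literature.NumberTheory.EllipticCurves.ModularForms Literature.NumberTheory.QuadraticFields
  IsDedekindDomain NumberField

namespace Summit.BirchSwinnertonDyer.Rank1Residual.Additive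

/-! ## §2 `f_W = (f_{W₀})_{χ_D}` for `W ≅ W₀ ⊗ χ_D` -/

section Newform

/-- `χ_D := (· / |D|)` (`jacobiChar`) is a quadratic character. [folklore] -/
theorem jacobiChar_isQuadratic' (m : ℕ) [NeZero m] : (jacobiChar m).IsQuadratic :=
  fun a ↦ jacobiChar_trichotomy a

/-- `|D|` is odd and square-free for an odd fundamental discriminant `D ≡ 1 (mod 4)` square-free.
[folklore] -/
theorem odd_natAbs_and_squarefree_of_emod_four_eq_one {D : ℤ} (hD4 : D % 4 = 1) (hsq : Squarefree D) :
    Odd D.natAbs ∧ Squarefree D.natAbs := by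
  refine ⟨Int.natAbs_odd.mpr (Int.odd_iff.mpr (by omega)), Int.squarefree_natAbs.mpr hsq⟩

/-- `χ_D(−1) = sign D`: `χ_D` is EVEN for `D > 0` (`|D| ≡ 1 mod 4`). [folklore] -/
theorem jacobiChar_natAbs_even_of_pos {D : ℤ} (hD4 : D % 4 = 1) (hD : 0 < D) [NeZero D.natAbs] :
    (jacobiChar D.natAbs).Even := by
  have hodd : Odd D.natAbs := Int.natAbs_odd.mpr (Int.odd_iff.mpr (by omega))
  have hm4 : D.natAbs % 4 = 1 := by omega
  show jacobiChar D.natAbs (-1) = 1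
  have h := jacobiChar_intCast (q := D.natAbs) (-1)
  push_cast at h
  rw [h, jacobiSym.at_neg_one hodd, ZMod.χ₄_nat_one_mod_four hm4]
  push_cast; rfl

/-- `χ_D` is ODD for `D < 0` (`|D| ≡ 3 mod 4`). [folklore] -/
theorem jacobiChar_natAbs_odd_of_neg {D : ℤ} (hD4 : D % 4 = 1) (hD : D < 0) [NeZero D.natAbs] :
    (jacobiChar D.natAbs).Odd := by
  have hodd : Odd D.natAbs := Int.natAbs_odd.mpr (Int.odd_iff.mpr (by omega))
  have hm4 : D.natAbs % 4 = 3 := by omega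
  show jacobiChar D.natAbs (-1) = -1
  have h := jacobiChar_intCast (q := D.natAbs) (-1)
  push_cast at h
  rw [h, jacobiSym.at_neg_one hodd, ZMod.χ₄_nat_three_mod_four hm4]
  push_cast; rfl

variable (W₀ W : WeierstrassCurve ℚ) [W₀.IsElliptic] [W₀.IsGloballyMinimal]

/-- **`f_W = (f_{W₀})_{χ_D}`**: for `W ≅ W₀ ⊗ χ_D` (`C • W₀^{(D)} = W`), `D ≡ 1 (mod 4)` square-free with
the twist additive at the primes dividing `D`, the newform of `W` at a level `N_W` with `N₀ ∣ N_W`,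
`|D|² ∣ N_W` IS the `χ_D`-twist of the newform of `W₀` (`q`-expansions agree: `aₙ(W) = χ_D(n)aₙ(W₀)`,
§1, and `aₙ(f ⊗ χ) = χ(n)aₙ(f)`). The general-`D` form of GEN 21's `charTwist_eq_of_isNewformOf`.
[cite: MazurTateTeitelbaum1986Invent, §I.8] -/
theorem charTwist_eq_of_isNewformOf_quadraticTwist {D : ℤ} (hD4 : D % 4 = 1) (hsq : Squarefree D)
    (hVW : ∃ C : VariableChange ℚ, C • W₀.quadraticTwist (D : ℚ) = W)
    (hadd : ∀ v : HeightOneSpectrum (𝓞 ℚ), ((Rat.HeightOneSpectrum.primesEquiv v : ℕ) : ℤ) ∣ D →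
      (W₀.quadraticTwist (D : ℚ)).HasAdditiveReductionAt v)
    {N₀ NW : ℕ} [NeZero N₀] [NeZero NW] [NeZero D.natAbs] {f₀ : CuspForm (Gamma0 N₀) 2}
    {fW : CuspForm (Gamma0 NW) 2} (hf₀ : IsNewformOf W₀ f₀) (hfW : IsNewformOf W fW)
    (hN : N₀ ∣ NW) (hm : D.natAbs ^ 2 ∣ NW) :
    charTwist NW hN hm (jacobiChar_isQuadratic' D.natAbs) f₀ = fW := by
  obtain ⟨hodd, hsq'⟩ := odd_natAbs_and_squarefree_of_emod_four_eq_one hD4 hsq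
  have hprim := isPrimitive_jacobiChar hodd hsq'
  obtain ⟨C, hC⟩ := hVW
  have hD0 : D ≠ 0 := by rintro rfl; norm_num at hD4
  haveI : (W₀.quadraticTwist (D : ℚ)).IsElliptic :=
    W₀.isElliptic_quadraticTwist (by exact_mod_cast hD0)
  refine eq_of_forall_cuspCoeff_eq_gamma0 fun n ↦ ?_
  rw [cuspCoeff_charTwist NW hN hm _ hprim f₀ n, hfW.2 n, hf₀.2 n, ← hC, LFunction_smul,
    lFunction_quadraticTwist_apply_of_hasAdditiveReductionAt W₀ hD4 hsq hadd n, jacobiChar_natCast]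
  push_cast
  ring

end Newform

/-! ## §3 The ℚ-identity with ONE constant: `[r]⁺_{f_W} = c₀ · ∑_{u mod |D|} (u/|D|) [r + u/|D|]^{sgn D}_{f_{W₀}}` -/

section Symbol

variable (W₀ W : WeierstrassCurve ℚ) [W₀.IsElliptic] [W₀.IsGloballyMinimal]

/-- **`D > 0` (even `χ_D`): `[r]⁺_{f_W} = c₀ · ∑_{u mod D} (u/D)·[r + u/D]⁺_{f_{W₀}}` with ONE
`c₀ ∈ ℚ`**, and `c₀ · Ω⁺_{f_W} · τ(χ_D) = Ω⁺_{f_{W₀}}` whenever some twisted sum is non-zero (tree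
`exists_rat_forall_ratPlusSymbol_charTwist_eq` — Shimura 3.64 at the symbol level — and §2).
[cite: MazurTateTeitelbaum1986Invent, §I.8] -/
theorem exists_rat_ratPlusSymbol_eq_twistSum_of_pos {D : ℤ} (hD4 : D % 4 = 1) (hsq : Squarefree D)
    (hD : 0 < D) (hVW : ∃ C : VariableChange ℚ, C • W₀.quadraticTwist (D : ℚ) = W)
    (hadd : ∀ v : HeightOneSpectrum (𝓞 ℚ), ((Rat.HeightOneSpectrum.primesEquiv v : ℕ) : ℤ) ∣ D →
      (W₀.quadraticTwist (D : ℚ)).HasAdditiveReductionAt v)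
    {N₀ NW : ℕ} [NeZero N₀] [NeZero NW] [NeZero D.natAbs] {f₀ : CuspForm (Gamma0 N₀) 2}
    {fW : CuspForm (Gamma0 NW) 2} (hf₀ : IsNewformOf W₀ f₀) (hfW : IsNewformOf W fW)
    (hN : N₀ ∣ NW) (hm : D.natAbs ^ 2 ∣ NW) :
    ∃ c₀ : ℚ, (∀ r : ℚ, ratPlusSymbol fW r =
        c₀ * ∑ u : ZMod D.natAbs, (J((u.val : ℤ) | D.natAbs) : ℚ) *
          ratPlusSymbol f₀ (r + (u.val : ℚ) / D.natAbs)) ∧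
      ((∃ r : ℚ, ∑ u : ZMod D.natAbs, (J((u.val : ℤ) | D.natAbs) : ℚ) *
          ratPlusSymbol f₀ (r + (u.val : ℚ) / D.natAbs) ≠ 0) →
        (c₀ : ℂ) * (plusPeriod fW : ℂ) *
            gaussSum (jacobiChar D.natAbs) (ZMod.stdAddChar (N := D.natAbs)) = (plusPeriod f₀ : ℂ)) := by
  obtain ⟨hodd, hsq'⟩ := odd_natAbs_and_squarefree_of_emod_four_eq_one hD4 hsq
  have hprim := isPrimitive_jacobiChar hodd hsq'
  have hFW := charTwist_eq_of_isNewformOf_quadraticTwist W₀ W hD4 hsq hVW hadd hf₀ hfW hN hm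
  have hε : ∀ u : ZMod D.natAbs, jacobiChar D.natAbs u =
      (((fun u : ZMod D.natAbs ↦ J((u.val : ℤ) | D.natAbs)) u : ℤ) : ℂ) := fun u ↦ jacobiChar_apply u
  have hF : IsNewform0 (charTwist NW hN hm (jacobiChar_isQuadratic' D.natAbs) f₀) := by
    rw [hFW]; exact hfW.1
  have hQF : coeffField (charTwist NW hN hm (jacobiChar_isQuadratic' D.natAbs) f₀) = ⊥ := by
    rw [hFW]; exact hfW.coeffField_eq_bot
  obtain ⟨c, hc, hrel⟩ := exists_rat_forall_ratPlusSymbol_charTwist_eq NW hN hm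
    (jacobiChar_isQuadratic' D.natAbs) (jacobiChar_natAbs_even_of_pos hD4 hD) hprim hf₀.1
    hf₀.coeffField_eq_bot hF hQF (fun u : ZMod D.natAbs ↦ J((u.val : ℤ) | D.natAbs)) hε
  rw [hFW] at hc hrel
  exact ⟨c, fun r ↦ by simpa only [twistShift] using hc r,
    fun ⟨r, hr⟩ ↦ hrel ⟨r, by simpa only [twistShift] using hr⟩⟩

/-- **`D < 0` (odd `χ_D`): `[r]⁺_{f_W} = c₀ · ∑_{u mod |D|} (u/|D|)·[r + u/|D|]⁻_{f_{W₀}}` with ONE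
`c₀ ∈ ℚ`** — the plus symbol of the twist is a twisted sum of the MINUS symbol —, and
`c₀ · Ω⁺_{f_W} · τ(χ_D) = i · Ω⁻_{f_{W₀}}` whenever some twisted sum is non-zero (tree
`exists_rat_forall_ratPlusSymbol_charTwist_eq_of_odd` and §2). [cite: MazurTateTeitelbaum1986Invent, §I.8] -/
theorem exists_rat_ratPlusSymbol_eq_twistSum_of_neg {D : ℤ} (hD4 : D % 4 = 1) (hsq : Squarefree D)
    (hD : D < 0) (hVW : ∃ C : VariableChange ℚ, C • W₀.quadraticTwist (D : ℚ) = W)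
    (hadd : ∀ v : HeightOneSpectrum (𝓞 ℚ), ((Rat.HeightOneSpectrum.primesEquiv v : ℕ) : ℤ) ∣ D →
      (W₀.quadraticTwist (D : ℚ)).HasAdditiveReductionAt v)
    {N₀ NW : ℕ} [NeZero N₀] [NeZero NW] [NeZero D.natAbs] {f₀ : CuspForm (Gamma0 N₀) 2}
    {fW : CuspForm (Gamma0 NW) 2} (hf₀ : IsNewformOf W₀ f₀) (hfW : IsNewformOf W fW)
    (hN : N₀ ∣ NW) (hm : D.natAbs ^ 2 ∣ NW) :
    ∃ c₀ : ℚ, (∀ r : ℚ, ratPlusSymbol fW r =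
        c₀ * ∑ u : ZMod D.natAbs, (J((u.val : ℤ) | D.natAbs) : ℚ) *
          ratMinusSymbol f₀ (r + (u.val : ℚ) / D.natAbs)) ∧
      ((∃ r : ℚ, ∑ u : ZMod D.natAbs, (J((u.val : ℤ) | D.natAbs) : ℚ) *
          ratMinusSymbol f₀ (r + (u.val : ℚ) / D.natAbs) ≠ 0) →
        (c₀ : ℂ) * (plusPeriod fW : ℂ) *
            gaussSum (jacobiChar D.natAbs) (ZMod.stdAddChar (N := D.natAbs)) =
          (minusPeriod f₀ : ℂ) * Complex.I) := by
  obtain ⟨hodd, hsq'⟩ := odd_natAbs_and_squarefree_of_emod_four_eq_one hD4 hsq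
  have hprim := isPrimitive_jacobiChar hodd hsq'
  have hFW := charTwist_eq_of_isNewformOf_quadraticTwist W₀ W hD4 hsq hVW hadd hf₀ hfW hN hm
  have hε : ∀ u : ZMod D.natAbs, jacobiChar D.natAbs u =
      (((fun u : ZMod D.natAbs ↦ J((u.val : ℤ) | D.natAbs)) u : ℤ) : ℂ) := fun u ↦ jacobiChar_apply u
  have hF : IsNewform0 (charTwist NW hN hm (jacobiChar_isQuadratic' D.natAbs) f₀) := by
    rw [hFW]; exact hfW.1
  have hQF : coeffField (charTwist NW hN hm (jacobiChar_isQuadratic' D.natAbs) f₀) = ⊥ := by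
    rw [hFW]; exact hfW.coeffField_eq_bot
  obtain ⟨c, hc, hrel⟩ := exists_rat_forall_ratPlusSymbol_charTwist_eq_of_odd NW hN hm
    (jacobiChar_isQuadratic' D.natAbs) (jacobiChar_natAbs_odd_of_neg hD4 hD) hprim hf₀.1
    hf₀.coeffField_eq_bot hF hQF (fun u : ZMod D.natAbs ↦ J((u.val : ℤ) | D.natAbs)) hε
  rw [hFW] at hc hrel
  exact ⟨c, fun r ↦ by simpa only [twistShift] using hc r,
    fun ⟨r, hr⟩ ↦ hrel ⟨r, by simpa only [twistShift] using hr⟩⟩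

end Symbol

/-! ## §4 The constant is a `p`-adic unit at every odd prime `p` (Pal 2012 Thm. 3.2, PROVED in the tree for every such `D`) -/

section Unit

variable (p : ℕ) [hp : Fact p.Prime]

omit hp in
/-- A rational whose square is the square of a `p`-adic unit is a `p`-adic unit. [folklore] -/
theorem norm_ratCast_eq_one_of_sq_eq {c q : ℚ} [Fact p.Prime] (h : c ^ 2 = q ^ 2)
    (hq : ‖(q : ℚ_[p])‖ = 1) : ‖(c : ℚ_[p])‖ = 1 := by
  rcases sq_eq_sq_iff_eq_or_eq_neg.mp h with h' | h'
  · rw [h', hq]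
  · rw [h']; push_cast; rw [norm_neg, hq]

/-- `τ(χ_D)² = D` for the primitive quadratic character `χ_D` mod `|D|` (`D ≡ 1 mod 4` square-free):
`τ(χ)τ(χ⁻¹) = χ(−1)|D|` (tree `gaussSum_mul_gaussSum_inv`), `χ⁻¹ = χ`, `χ(−1)|D| = D`. [folklore] -/
theorem gaussSum_jacobiChar_mul_self {D : ℤ} (hD4 : D % 4 = 1) (hsq : Squarefree D) [NeZero D.natAbs] :
    gaussSum (jacobiChar D.natAbs) (ZMod.stdAddChar (N := D.natAbs)) *
      gaussSum (jacobiChar D.natAbs) (ZMod.stdAddChar (N := D.natAbs)) = (D : ℂ) := by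
  obtain ⟨hodd, hsq'⟩ := odd_natAbs_and_squarefree_of_emod_four_eq_one hD4 hsq
  have hprim := isPrimitive_jacobiChar hodd hsq'
  have h := Literature.NumberTheory.Sieve.LargeSieve.gaussSum_mul_gaussSum_inv hprim
  rw [(jacobiChar_isQuadratic' D.natAbs).inv] at h
  rw [h]
  rcases lt_or_gt_of_ne (show D ≠ 0 by rintro rfl; norm_num at hD4) with hneg | hpos
  · rw [jacobiChar_natAbs_odd_of_neg hD4 hneg]
    have : ((D.natAbs : ℕ) : ℂ) = -(D : ℂ) := by
      rw [Nat.cast_natAbs, abs_of_neg hneg]; push_cast; ring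
    rw [this]; ring
  · rw [jacobiChar_natAbs_even_of_pos hD4 hpos]
    have : ((D.natAbs : ℕ) : ℂ) = (D : ℂ) := by
      rw [Nat.cast_natAbs, abs_of_pos hpos]
    rw [this]; ring

variable (W₀ W : WeierstrassCurve ℚ) [W₀.IsElliptic] [W₀.IsGloballyMinimal] [W.IsElliptic]
  [W.IsGloballyMinimal]

/-- **`|c₀|_p = 1`, `D > 0`.** From `c₀ · Ω⁺_{f_W} · τ(χ_D) = Ω⁺_{f_{W₀}}`, `τ(χ_D)² = D`, Pal 2012
Thm. 3.2 with `ũ = 1` (`√D · Ω(W) = Ω(W₀)`, PROVED in the tree: `W₀` good or multiplicative at the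
primes dividing `D`, both curves globally minimal) and the period transfers `Ω(W) = u_W Ω⁺_{f_W}`,
`Ω(W₀) = u₀ Ω⁺_{f_{W₀}}` with `p`-adic units: `c₀² = (u_W/u₀)²`. Any prime `p`.
[cite: Pal2012, Thm. 3.2 with Prop. 2.5] -/
theorem norm_ratCast_eq_one_of_twist_of_pos {D : ℤ} (hD4 : D % 4 = 1) (hsq : Squarefree D)
    (hD : 0 < D) (C : VariableChange ℚ) (hC : C • W₀.quadraticTwist (D : ℚ) = W)
    (hgm : ∀ v : HeightOneSpectrum (𝓞 ℚ), ((Rat.HeightOneSpectrum.primesEquiv v : ℕ) : ℤ) ∣ D →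
      W₀.HasGoodReductionAt v ∨ W₀.HasMultiplicativeReductionAt v)
    {N₀ NW : ℕ} [NeZero D.natAbs] {f₀ : CuspForm (Gamma0 N₀) 2} {fW : CuspForm (Gamma0 NW) 2}
    {uW u₀ c₀ : ℚ} (huW : ‖(uW : ℚ_[p])‖ = 1) (hu₀ : ‖(u₀ : ℚ_[p])‖ = 1)
    (hΩW : W.realPeriodRat = uW * plusPeriod fW) (hΩ₀ : W₀.realPeriodRat = u₀ * plusPeriod f₀)
    (hrel : (c₀ : ℂ) * (plusPeriod fW : ℂ) *
      gaussSum (jacobiChar D.natAbs) (ZMod.stdAddChar (N := D.natAbs)) = (plusPeriod f₀ : ℂ)) :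
    ‖(c₀ : ℚ_[p])‖ = 1 := by
  have hu₀0 : u₀ ≠ 0 := by rintro rfl; simp at hu₀
  have hPal := W₀.sqrt_mul_realPeriodRat_eq_of_twist_of_pos_of_squarefree hD hD4 hsq hgm W C hC
  have hg := gaussSum_jacobiChar_mul_self hD4 hsq
  set g := gaussSum (jacobiChar D.natAbs) (ZMod.stdAddChar (N := D.natAbs)) with hgdef
  -- square the complex relation and remove the Gauss sum
  have h1 : ((c₀ : ℂ) * (plusPeriod fW : ℂ)) ^ 2 * (g * g) = (plusPeriod f₀ : ℂ) ^ 2 := by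
    rw [← hrel]; ring
  rw [hg] at h1
  have h2 : ((c₀ : ℝ) * plusPeriod fW) ^ 2 * (D : ℝ) = (plusPeriod f₀) ^ 2 := by exact_mod_cast h1
  -- square Pal's relation
  have hDR : (0 : ℝ) ≤ D := by exact_mod_cast hD.le
  have h3 : (D : ℝ) * W.realPeriodRat ^ 2 = W₀.realPeriodRat ^ 2 := by
    rw [← hPal, mul_pow, Real.sq_sqrt hDR]
  rw [hΩW, hΩ₀] at h3
  have hF0 : plusPeriod fW ≠ 0 := by
    intro h0
    have hpos : 0 < W.realPeriodRat := W.realPeriodRat_pos_holds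
    rw [hΩW, h0, mul_zero] at hpos
    exact lt_irrefl _ hpos
  have hD0 : (D : ℝ) ≠ 0 := by exact_mod_cast hD.ne'
  -- `(u₀ c₀)² (Ω_F² D) = u_W² (Ω_F² D)`
  have h4 : ((u₀ : ℝ) * c₀) ^ 2 * (plusPeriod fW ^ 2 * D) = (uW : ℝ) ^ 2 * (plusPeriod fW ^ 2 * D) := by
    linear_combination ((u₀ : ℝ)) ^ 2 * h2 - h3
  have h5 : ((u₀ : ℝ) * c₀) ^ 2 = (uW : ℝ) ^ 2 :=
    mul_right_cancel₀ (mul_ne_zero (pow_ne_zero 2 hF0) hD0) h4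
  have h6 : (c₀ : ℚ) ^ 2 = (uW / u₀) ^ 2 := by
    have h5' : ((u₀ * c₀ : ℚ) : ℝ) ^ 2 = ((uW : ℚ) : ℝ) ^ 2 := by push_cast; exact h5
    have h5'' : (u₀ * c₀) ^ 2 = uW ^ 2 := by exact_mod_cast h5'
    field_simp
    linear_combination h5''
  refine norm_ratCast_eq_one_of_sq_eq p h6 ?_
  push_cast
  rw [norm_div, huW, hu₀, div_one]

/-- **`|c₀|_p = 1`, `D < 0`, `p` odd.** From `c₀ · Ω⁺_{f_W} · τ(χ_D) = i · Ω⁻_{f_{W₀}}`, `τ(χ_D)² = D`,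
Pal 2012 Thm. 3.2 with `ũ = 1` for `d < 0` (`Ω(W) · √|D| = c_∞(W) · |Ω⁻(W₀)|`, PROVED in the tree) and
the transfers `Ω(W) = u_W Ω⁺_{f_W}`, `|Ω⁻(W₀)| = u₀ Ω⁻_{f_{W₀}}` with `p`-adic units:
`c₀² = (u_W/(c_∞ u₀))²`, `c_∞ ∈ {1, 2}` a unit at odd `p`. [cite: Pal2012, Thm. 3.2 with Prop. 2.5 and p. 1514 (Ω⁻)] -/
theorem norm_ratCast_eq_one_of_twist_of_neg (hp2 : p ≠ 2) {D : ℤ} (hD4 : D % 4 = 1)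
    (hsq : Squarefree D) (hD : D < 0) (C : VariableChange ℚ) (hC : C • W₀.quadraticTwist (D : ℚ) = W)
    (hgm : ∀ v : HeightOneSpectrum (𝓞 ℚ), ((Rat.HeightOneSpectrum.primesEquiv v : ℕ) : ℤ) ∣ D →
      W₀.HasGoodReductionAt v ∨ W₀.HasMultiplicativeReductionAt v)
    {N₀ NW : ℕ} [NeZero D.natAbs] {f₀ : CuspForm (Gamma0 N₀) 2} {fW : CuspForm (Gamma0 NW) 2}
    {uW u₀ c₀ : ℚ} (huW : ‖(uW : ℚ_[p])‖ = 1) (hu₀ : ‖(u₀ : ℚ_[p])‖ = 1)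
    (hΩW : W.realPeriodRat = uW * plusPeriod fW) (hΩ₀ : W₀.imaginaryPeriodRat = u₀ * minusPeriod f₀)
    (hrel : (c₀ : ℂ) * (plusPeriod fW : ℂ) *
      gaussSum (jacobiChar D.natAbs) (ZMod.stdAddChar (N := D.natAbs)) =
        (minusPeriod f₀ : ℂ) * Complex.I) :
    ‖(c₀ : ℚ_[p])‖ = 1 := by
  have hu₀0 : u₀ ≠ 0 := by rintro rfl; simp at hu₀
  have hPal := W₀.realPeriodRat_mul_sqrt_eq_of_twist_of_neg_of_squarefree hD hD4 hsq hgm W C hC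
  have hg := gaussSum_jacobiChar_mul_self hD4 hsq
  set g := gaussSum (jacobiChar D.natAbs) (ZMod.stdAddChar (N := D.natAbs)) with hgdef
  set cinf : ℕ := (W.baseChange ℝ).numRealComponents with hcinfdef
  -- square the complex relation: `c₀² Ω_F² D = (Ω⁻ i)² = −Ω⁻²`
  have h1 : ((c₀ : ℂ) * (plusPeriod fW : ℂ)) ^ 2 * (g * g) = ((minusPeriod f₀ : ℂ) * Complex.I) ^ 2 := by
    rw [← hrel]; ring
  rw [hg] at h1
  have h2 : ((c₀ : ℝ) * plusPeriod fW) ^ 2 * (-(D : ℝ)) = (minusPeriod f₀) ^ 2 := by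
    have h1' : ((c₀ : ℂ) * (plusPeriod fW : ℂ)) ^ 2 * (-(D : ℂ)) = (minusPeriod f₀ : ℂ) ^ 2 := by
      linear_combination -h1 - ((minusPeriod f₀ : ℂ)) ^ 2 * Complex.I_sq
    exact_mod_cast h1'
  -- square Pal's relation
  have hDlt : (D : ℝ) < 0 := by exact_mod_cast hD
  have hDR : (0 : ℝ) ≤ -(D : ℝ) := by linarith
  have h3 : W.realPeriodRat ^ 2 * (-(D : ℝ)) = (cinf : ℝ) ^ 2 * W₀.imaginaryPeriodRat ^ 2 := by
    rw [← mul_pow, ← hPal, mul_pow, Real.sq_sqrt hDR]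
  rw [hΩW, hΩ₀] at h3
  have hF0 : plusPeriod fW ≠ 0 := by
    intro h0
    have hpos : 0 < W.realPeriodRat := W.realPeriodRat_pos_holds
    rw [hΩW, h0, mul_zero] at hpos
    exact lt_irrefl _ hpos
  have hD0 : -(D : ℝ) ≠ 0 := by linarith
  have h4 : ((cinf : ℝ) * u₀ * c₀) ^ 2 * (plusPeriod fW ^ 2 * (-(D : ℝ))) =
      (uW : ℝ) ^ 2 * (plusPeriod fW ^ 2 * (-(D : ℝ))) := by
    linear_combination ((cinf : ℝ) * u₀) ^ 2 * h2 - h3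
  have h5 : ((cinf : ℝ) * u₀ * c₀) ^ 2 = (uW : ℝ) ^ 2 :=
    mul_right_cancel₀ (mul_ne_zero (pow_ne_zero 2 hF0) hD0) h4
  have hcinf0 : (cinf : ℚ) ≠ 0 := by
    have := (W.baseChange ℝ).numRealComponents_pos
    exact_mod_cast this.ne'
  have h6 : (c₀ : ℚ) ^ 2 = (uW / ((cinf : ℚ) * u₀)) ^ 2 := by
    have h5' : (((cinf : ℚ) * u₀ * c₀ : ℚ) : ℝ) ^ 2 = ((uW : ℚ) : ℝ) ^ 2 := by push_cast; exact h5
    have h5'' : ((cinf : ℚ) * u₀ * c₀) ^ 2 = uW ^ 2 := by exact_mod_cast h5'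
    field_simp
    linear_combination h5''
  have hcinf : ‖((cinf : ℕ) : ℚ_[p])‖ = 1 := by
    rw [hcinfdef, numRealComponents]
    split_ifs
    · haveI : Fact (Nat.Prime 2) := ⟨Nat.prime_two⟩
      have h2' : padicNorm p ((2 : ℕ) : ℚ) = 1 := padicNorm.padicNorm_of_prime_of_ne hp2
      rw [Nat.cast_ofNat] at h2'
      rw [Nat.cast_ofNat, ← Rat.cast_ofNat, Padic.eq_padicNorm, h2', Rat.cast_one]
    · simp
  refine norm_ratCast_eq_one_of_sq_eq p h6 ?_
  push_cast
  rw [norm_div, norm_mul, huW, hu₀, hcinf, mul_one, div_one]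

end Unit

end Summit.BirchSwinnertonDyer.Rank1Residual.Additive

end
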